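import Summits.QuantumFields.YangMills.Theorems.UnitScaleTiltProp7UniquenessReduction
import Summits.QuantumFields.YangMills.Theorems.UnitScaleTiltProp7FlatDatum
import HarnessLib

/-!
# Route `UnitScaleTilt`, crux K1 «MinimiserStabilityRegPr» (stmt-QuantumFields-19200), registered stub `stub_prop7From14` (leaf V3 «Prop 7 from a
# background (14)») — **THE COMPACT-ORBIT CHART: print's group (4) is COMPACT, so every configuration has an `ℓ²`-OPTIMAL representative on its
# (4)-orbit relative to any background; the CHART HYPOTHESIS of the `ℓ²` uniqueness reduction (`Prop7UniquenessReduction`) is thereby DISCHARGED, and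
# the uniqueness clause of Prop. 7 reduces to quadratic growth at critical configurations for SOME (equivalently: the optimal) (4)-representative**

Cell `ym3-torus` ∕ fleet seat `ym-ust-19200-p1` (gen 6).  WHERE THIS SITS.  The lineage's `ℓ²` route to the uniqueness clause (p504929
`Prop7UniquenessReduction.atMostOneCriticalOrbit_of_chart_of_strictGrowth`) consumes TWO hypotheses: a CHART inside the group (4) (leaf V3-A =
[Balaban1985RegularSpaces] Thm 2 with sup-norm estimates, XL, open) and strict GROWTH along the chart.  Observation recorded here, kernel-checked: for the
chart relation «`W` is an `ℓ²`-optimal representative of its (4)-orbit relative to `U`», i.e. `Σ_b‖W_bU_b⁻¹ − 1‖² ≤ Σ_b‖(W^v)_bU_b⁻¹ − 1‖²` for every `v`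
with `v↓ = 1`, the chart hypothesis holds OUTRIGHT for every pair `(U, U′)` — the group (4) `{u : u = 1 at the (K−n)-fold block centres}` is a closed
subset of the compact group `SU(2)^{sites}` (§1), the functional `u ↦ Σ_b‖(U′^u)_bU_b⁻¹ − 1‖²` is continuous (§2), so a minimiser exists (§3, `exists_optimalRepr`;
no contraction, no Green's functions, no smallness).  Consequences (§4): **`atMostOneCriticalOrbit_of_optimalGrowth`** — the uniqueness clause at `(V, ε₀)`
⇐ strict growth `A(U) ≤ A(W)`, `=` only at `W = U`, for critical `U, W ∈ (6)(ε₀) ∩ fibre(V)` with `W` `ℓ²`-optimal relative to `U`;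
**`atMostOneCriticalOrbit_of_exists_reprGrowth`** — ⇐ for critical `U, W` SOME (4)-representative `W^v` with `κ·Σ_b‖(W^v)_bU_b⁻¹ − 1‖² ≤ A(W^v) − A(U)`,
`κ > 0`; and the TRANSFER `optimalGrowth_of_reprGrowth`: quadratic growth for any representative implies it for the optimal one with the same `κ`
(`Σ‖Y_opt‖² ≤ Σ‖Y_v‖²`, `A` gauge invariant) — so coercivity proved on ANY (4)-reachable gauge slice serves the optimal chart.  The optimal representative
is the lattice Landau gauge RELATIVE TO `U` restricted to the group (4) (stationarity = covariant divergence of the `𝔰𝔲(2)`-part of `Y` vanishing OFF the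
centres; the Euler–Lagrange form is not derived here).  What stays open for the `ℓ²` route is therefore exactly: quadratic growth at an R2-critical `U` for
one (4)-representative of each critical `W` — the engine on a (4)-compatible slice of the TRUE (0.4) constraint ((G)-true of CARD-g5) plus the sup-smallness
of that representative (the regularity content of V3-A), not the existence∕uniqueness of the chart.  Sorry-free, no definitions, nothing of Bałaban's used.

References: T. Bałaban, CMP 102 (1985) 277–309 [Balaban1985Variational] ((4)–(6), (15)–(16) pp.278–280, Prop. 2 p.281, Prop. 7 p.299); CMP 99 (1985)
75–102 [Balaban1985RegularSpaces] (Thm 2 p.83, (1.14), (1.19) pp.78–79); I. Montvay, G. Münster, *Quantum fields on a lattice* (1994) §4.2 (lattice Landau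
gauge by maximisation) [MontvayMunster1994].
-/

noncomputable section

namespace Summit.QuantumFields.YangMills.Theorems.Prop7CompactChart

open scoped BigOperators Matrix.Norms.L2Operator
open Literature.MathematicalPhysics.QuantumFieldTheory.Balaban1983to89
open T4Continuum B15DeterminingSets
open Literature.MathematicalPhysics.QuantumFieldTheory.Balaban1983to89.T3ContinuumYM3Torus
open Literature.MathematicalPhysics.QuantumFieldTheory.Balaban1983to89.T3LevelShift
open Literature.MathematicalPhysics.QuantumFieldTheory.Balaban1983to89.T3UnitLawDensityEML (ℰp)
open Literature.MathematicalPhysics.QuantumFieldTheory.Balaban1983to89.T3ConstrainedMinimiser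
open Literature.MathematicalPhysics.QuantumFieldTheory.Balaban1983to89.T3PrintedRegularMinimiser
open Literature.MathematicalPhysics.QuantumFieldTheory.Balaban1983to89.T3PrintedRegularOrbits (descTransf sites_eq)
open Literature.MathematicalPhysics.QuantumFieldTheory.Balaban1983to89.T3Thm1Carrier
open Literature.MathematicalPhysics.QuantumFieldTheory.Balaban1983to89.T3Thm1CarrierNative
open Literature.MathematicalPhysics.QuantumFieldTheory.Balaban1983to89.T3SectALandauChart (descTransf_mul descTransf_one isCritR2_gaugeAct_of_trivial)
open Literature.MathematicalPhysics.QuantumFieldTheory.Balaban1983to89.T3UnitLawGaugeInvariance (gaugeAct_gaugeAct)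
open Literature.MathematicalPhysics.QuantumFieldTheory.Balaban1983to89.T3PrintedRegularOrbits (gaugeAct_mem_regFibrePr_iff_of_trivial)
open BlockAveragingEMLLinearisedBackground (pertVar)
open Summit.QuantumFields.YangMills.Theorems.Prop7FlatHolonomy (transfUp_eq_embIter)
open Summit.QuantumFields.YangMills.Theorems.Prop7UniquenessReduction (sameOrbit_of_chart_of_strictGrowth strictGrowth_of_quadratic)

variable (F : T3Family) {n K : ℕ} (h : n ≤ K)

/-! ## §1 Print's group (4) is compact -/

/-- `u↓ = 1` IS `u = 1` at every `(K−n)`-fold block centre (`descTransf` = `transfUp` read through `siteShift`; `transfUp u k = u ∘ embIter k`).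
[cite: Balaban1985Variational, (4) p.278] -/
theorem descTransf_eq_one_iff {G : Type*} [GaugeGroup G] (u : GaugeTransf (F.P K) 0 G) :
    descTransf F n K h u = (fun _ => 1) ↔ ∀ y : Site (F.P K) (K - n), u (embIter (K - n) y) = 1 := by
  constructor
  · intro hu y
    have h1 := congrFun hu ((siteShift (sites_eq F n K h)).symm y)
    unfold descTransf at h1
    rwa [transfUp_eq_embIter, Equiv.apply_symm_apply] at h1
  · intro hu
    funext x
    unfold descTransf
    rw [transfUp_eq_embIter]
    exact hu _

/-- **THE GROUP (4) IS COMPACT**: `{u : T_η → SU(2) | u = 1 at the block centres}` is a closed subset of the compact group `SU(2)^{T_η}`.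
[cite: Balaban1985Variational, (4) p.278] -/
theorem isCompact_group4 :
    IsCompact {u : Site (F.P K) 0 → Matrix.specialUnitaryGroup (Fin 2) ℂ | descTransf F n K h u = fun _ => 1} := by
  have hset : {u : Site (F.P K) 0 → Matrix.specialUnitaryGroup (Fin 2) ℂ | descTransf F n K h u = fun _ => 1} =
      ⋂ y : Site (F.P K) (K - n), (fun u : Site (F.P K) 0 → Matrix.specialUnitaryGroup (Fin 2) ℂ => u (embIter (K - n) y)) ⁻¹' {1} := by
    ext u
    rw [Set.mem_setOf_eq, descTransf_eq_one_iff, Set.mem_iInter]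
    rfl
  rw [hset]
  exact (isClosed_iInter fun y => isClosed_singleton.preimage (continuous_apply _)).isCompact

/-! ## §2 The `ℓ²` distance to the background along an orbit is continuous -/

/-- `‖Y_b‖ = ‖W_bU_b⁻¹ − 1‖ = dist1 (W_bU_b⁻¹)` (the tree's `SU(2)` model: `dist1 g = ‖g − 1‖` in the fundamental representation). [cite: Balaban1985Variational, (15) p.280] -/
theorem norm_pertVar_eq_dist1 {P : Params} {j : ℕ} (U W : GaugeField P j (Matrix.specialUnitaryGroup (Fin 2) ℂ)) (b : PBond P j) :
    ‖pertVar U W b‖ = dist1 (W b * (U b)⁻¹) := rfl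

/-- The functional `u ↦ Σ_b ‖(W^u)_bU_b⁻¹ − 1‖²` is continuous on `SU(2)^{T_η}`. [folklore] -/
theorem continuous_sum_normSq_pertVar_gaugeAct (U W : GaugeField (F.P K) 0 (Matrix.specialUnitaryGroup (Fin 2) ℂ)) :
    Continuous fun u : Site (F.P K) 0 → Matrix.specialUnitaryGroup (Fin 2) ℂ =>
      ∑ b : PBond (F.P K) 0, ‖pertVar U (GaugeField.gaugeAct u W) b‖ ^ 2 := by
  refine continuous_finsetSum _ fun b _ => ?_
  refine Continuous.pow ?_ 2
  have hg : Continuous fun u : Site (F.P K) 0 → Matrix.specialUnitaryGroup (Fin 2) ℂ => u b.src * W b * (u b.tgt)⁻¹ * (U b)⁻¹ :=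
    ((((continuous_apply b.src).mul continuous_const).mul (continuous_apply b.tgt).inv).mul continuous_const)
  have hc : Continuous fun g : Matrix.specialUnitaryGroup (Fin 2) ℂ => ((g : Matrix (Fin 2) (Fin 2) ℂ) - 1) :=
    continuous_subtype_val.sub continuous_const
  exact (hc.comp hg).norm

/-! ## §3 The `ℓ²`-optimal representative on a (4)-orbit exists -/

/-- **EVERY CONFIGURATION HAS AN `ℓ²`-OPTIMAL REPRESENTATIVE ON ITS (4)-ORBIT RELATIVE TO ANY BACKGROUND**: there is `u` with `u↓ = 1` such that
`Σ_b ‖(W^u)_bU_b⁻¹ − 1‖² ≤ Σ_b ‖(W^v)_bU_b⁻¹ − 1‖²` for every `v` with `v↓ = 1` (minimum of a continuous function on the compact group (4) ∋ 1).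
No smallness, no contraction. [cite: Balaban1985Variational, (4) p.278, (16) p.280] -/
theorem exists_optimalRepr (U W : GaugeField (F.P K) 0 (Matrix.specialUnitaryGroup (Fin 2) ℂ)) :
    ∃ u : GaugeTransf (F.P K) 0 (Matrix.specialUnitaryGroup (Fin 2) ℂ), descTransf F n K h u = (fun _ => 1) ∧
      ∀ v : GaugeTransf (F.P K) 0 (Matrix.specialUnitaryGroup (Fin 2) ℂ), descTransf F n K h v = (fun _ => 1) →
        ∑ b : PBond (F.P K) 0, ‖pertVar U (GaugeField.gaugeAct u W) b‖ ^ 2 ≤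
          ∑ b : PBond (F.P K) 0, ‖pertVar U (GaugeField.gaugeAct v W) b‖ ^ 2 := by
  obtain ⟨u, hu, hmin⟩ := (isCompact_group4 F h).exists_isMinOn ⟨fun _ => 1, descTransf_one F h⟩
    (continuous_sum_normSq_pertVar_gaugeAct F U W).continuousOn
  exact ⟨u, hu, fun v hv => hmin hv⟩

/-- **THE CHART HYPOTHESIS OF `Prop7UniquenessReduction` DISCHARGED** for the relation «`ℓ²`-optimal representative relative to `U`»: for EVERY pair
`U, U′` there is `u` in the group (4) such that `U′^u` is `ℓ²`-optimal on its own (= `U′`'s) (4)-orbit relative to `U`. [cite: Balaban1985Variational, Prop. 2 p.281] -/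
theorem chart_optimal (U U' : GaugeField (F.P K) 0 (Matrix.specialUnitaryGroup (Fin 2) ℂ)) :
    ∃ u : GaugeTransf (F.P K) 0 (Matrix.specialUnitaryGroup (Fin 2) ℂ), descTransf F n K h u = (fun _ => 1) ∧
      ∀ v : GaugeTransf (F.P K) 0 (Matrix.specialUnitaryGroup (Fin 2) ℂ), descTransf F n K h v = (fun _ => 1) →
        ∑ b : PBond (F.P K) 0, ‖pertVar U (GaugeField.gaugeAct u U') b‖ ^ 2 ≤
          ∑ b : PBond (F.P K) 0, ‖pertVar U (GaugeField.gaugeAct v (GaugeField.gaugeAct u U')) b‖ ^ 2 := by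
  obtain ⟨u, hu, hmin⟩ := exists_optimalRepr F h U U'
  refine ⟨u, hu, fun v hv => ?_⟩
  rw [gaugeAct_gaugeAct]
  apply hmin
  rw [descTransf_mul, hv, hu]
  funext x; exact one_mul 1

/-! ## §4 The uniqueness clause from growth along `ℓ²`-optimal (or along some) representatives -/

/-- **THE UNIQUENESS CLAUSE OF [7] PROP. 7 FROM STRICT GROWTH ALONG `ℓ²`-OPTIMAL REPRESENTATIVES** (at a datum `V` and radius `ε₀ ≥ 0`, reading R2):
if for all critical `U, W ∈ (6)(ε₀) ∩ fibre(V)` with `W` `ℓ²`-optimal relative to `U` on its (4)-orbit one has `A(U) ≤ A(W)` with equality only at `W = U`,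
then any two critical configurations in `(6)(ε₀) ∩ fibre(V)` lie on one (4)-orbit.  The chart is supplied by compactness (`chart_optimal`).
[cite: Balaban1985Variational, Prop. 7 p.299] -/
theorem atMostOneCriticalOrbit_of_optimalGrowth {ε₀ : ℝ} (hε : 0 ≤ ε₀)
    (V : GaugeField (F.P n) 0 (Matrix.specialUnitaryGroup (Fin 2) ℂ))
    (hgrowth : ∀ U W : GaugeField (F.P K) 0 (Matrix.specialUnitaryGroup (Fin 2) ℂ),
      U ∈ regFibrePr F n K h ε₀ V → IsCritR2 F n K h V U → W ∈ regFibrePr F n K h ε₀ V → IsCritR2 F n K h V W →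
      (∀ v : GaugeTransf (F.P K) 0 (Matrix.specialUnitaryGroup (Fin 2) ℂ), descTransf F n K h v = (fun _ => 1) →
        ∑ b : PBond (F.P K) 0, ‖pertVar U W b‖ ^ 2 ≤ ∑ b : PBond (F.P K) 0, ‖pertVar U (GaugeField.gaugeAct v W) b‖ ^ 2) →
        wilsonAction4 U ≤ wilsonAction4 W ∧ (wilsonAction4 W = wilsonAction4 U → W = U)) :
    (varProblem3 F n K h).AtMostOneCriticalOrbit ε₀ V := by
  intro U U' hU hB hc hU' hB' hc'
  exact sameOrbit_of_chart_of_strictGrowth F n K h hε V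
    (fun U W => ∀ v : GaugeTransf (F.P K) 0 (Matrix.specialUnitaryGroup (Fin 2) ℂ), descTransf F n K h v = (fun _ => 1) →
      ∑ b : PBond (F.P K) 0, ‖pertVar U W b‖ ^ 2 ≤ ∑ b : PBond (F.P K) 0, ‖pertVar U (GaugeField.gaugeAct v W) b‖ ^ 2)
    (fun U U' _ _ _ _ => chart_optimal F h U U') hgrowth
    ((mem_regFibrePr_iff F).mpr ⟨hB, hU⟩) hc ((mem_regFibrePr_iff F).mpr ⟨hB', hU'⟩) hc'

/-- Vanishing `ℓ²` distance to the background means equality. [cite: Balaban1985Variational, (15) p.280] -/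
theorem eq_of_sum_normSq_pertVar_eq_zero {P : Params} {j : ℕ} (U W : GaugeField P j (Matrix.specialUnitaryGroup (Fin 2) ℂ))
    (h0 : ∑ b : PBond P j, ‖pertVar U W b‖ ^ 2 = 0) : W = U :=
  Prop7UniquenessReduction.eq_of_pertVar_eq_zero U W fun b => by
    have hb := (Finset.sum_eq_zero_iff_of_nonneg fun b _ => sq_nonneg (‖pertVar U W b‖)).mp h0 b (Finset.mem_univ b)
    rwa [sq_eq_zero_iff, norm_eq_zero] at hb

/-- **TRANSFER**: quadratic growth for SOME representative `W′^v` (`v↓ = 1`) of the (4)-orbit of an `ℓ²`-OPTIMAL representative `W′` gives quadratic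
growth for `W′` itself with the same constant (`Σ‖Y(W′)‖² ≤ Σ‖Y(W′^v)‖²`, `A(W′^v) = A(W′)`).  So a coercivity estimate on ANY gauge slice reachable inside
the group (4) serves the optimal chart. [cite: Balaban1985Variational, (141)-(143) p.299] -/
theorem optimalGrowth_of_reprGrowth {κ : ℝ} (hκ : 0 ≤ κ) (U W' : GaugeField (F.P K) 0 (Matrix.specialUnitaryGroup (Fin 2) ℂ))
    (hopt : ∀ v : GaugeTransf (F.P K) 0 (Matrix.specialUnitaryGroup (Fin 2) ℂ), descTransf F n K h v = (fun _ => 1) →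
      ∑ b : PBond (F.P K) 0, ‖pertVar U W' b‖ ^ 2 ≤ ∑ b : PBond (F.P K) 0, ‖pertVar U (GaugeField.gaugeAct v W') b‖ ^ 2)
    {v : GaugeTransf (F.P K) 0 (Matrix.specialUnitaryGroup (Fin 2) ℂ)} (hv : descTransf F n K h v = fun _ => 1)
    (hq : κ * ∑ b : PBond (F.P K) 0, ‖pertVar U (GaugeField.gaugeAct v W') b‖ ^ 2 ≤
      wilsonAction4 (GaugeField.gaugeAct v W') - wilsonAction4 U) :
    κ * ∑ b : PBond (F.P K) 0, ‖pertVar U W' b‖ ^ 2 ≤ wilsonAction4 W' - wilsonAction4 U := by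
  rw [show wilsonAction4 (GaugeField.gaugeAct v W') = wilsonAction4 W' from T4WilsonGaugeFlatDirection.wilsonAction_gaugeAct 1 v W'] at hq
  exact le_trans (mul_le_mul_of_nonneg_left (hopt v hv) hκ) hq

/-- **THE UNIQUENESS CLAUSE OF [7] PROP. 7 FROM QUADRATIC GROWTH ALONG SOME (4)-REPRESENTATIVE** (at a datum `V` and radius `ε₀ ≥ 0`, reading R2):
if for all critical `U, W ∈ (6)(ε₀) ∩ fibre(V)` some `v` with `v↓ = 1` and some `κ > 0` satisfy `κ·Σ_b‖(W^v)_bU_b⁻¹ − 1‖² ≤ A(W^v) − A(U)`, then any two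
critical configurations in `(6)(ε₀) ∩ fibre(V)` lie on one (4)-orbit (`Prop7UniquenessReduction.atMostOneCriticalOrbit_of_chart_of_quadraticGrowth` with
the chart relation «quadratic growth holds»; by `optimalGrowth_of_reprGrowth` the `ℓ²`-optimal representative is a universal witness).
[cite: Balaban1985Variational, Prop. 7 p.299] -/
theorem atMostOneCriticalOrbit_of_exists_reprGrowth {ε₀ : ℝ} (hε : 0 ≤ ε₀)
    (V : GaugeField (F.P n) 0 (Matrix.specialUnitaryGroup (Fin 2) ℂ))
    (hrepr : ∀ U W : GaugeField (F.P K) 0 (Matrix.specialUnitaryGroup (Fin 2) ℂ),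
      U ∈ regFibrePr F n K h ε₀ V → IsCritR2 F n K h V U → W ∈ regFibrePr F n K h ε₀ V → IsCritR2 F n K h V W →
        ∃ v : GaugeTransf (F.P K) 0 (Matrix.specialUnitaryGroup (Fin 2) ℂ), descTransf F n K h v = (fun _ => 1) ∧
          ∃ κ : ℝ, 0 < κ ∧ κ * ∑ b : PBond (F.P K) 0, ‖pertVar U (GaugeField.gaugeAct v W) b‖ ^ 2 ≤
            wilsonAction4 (GaugeField.gaugeAct v W) - wilsonAction4 U) :
    (varProblem3 F n K h).AtMostOneCriticalOrbit ε₀ V := by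
  intro U U' hU hB hc hU' hB' hc'
  exact Prop7UniquenessReduction.atMostOneCriticalOrbit_of_chart_of_quadraticGrowth F n K h hε V
    (fun U W => ∃ κ : ℝ, 0 < κ ∧ κ * ∑ b : PBond (F.P K) 0, ‖pertVar U W b‖ ^ 2 ≤ wilsonAction4 W - wilsonAction4 U)
    (fun U U' hU hcU hU' hcU' => hrepr U U' hU hcU hU' hcU') (fun U W _ _ _ _ hG => hG) U U' hU hB hc hU' hB' hc'

/-! ## §5 Clause 1 of the registered stub from quadratic growth along one (4)-representative (the remaining analytic input, displayed) -/

/-- **CLAUSE 1 OF `stub_prop7From14` IN ITS REGISTERED BINDER SHAPE FROM ONE DISPLAYED HYPOTHESIS** — quadratic growth of the Wilson action at every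
reading-R2 critical configuration along SOME representative, in print's group (4), of every other critical configuration of the same space (6)(ε₀) ∩ fibre(V):
if for some `a₀ > 0` and every member, every `ε₀ ≤ a₀` with `B₃ε₁ ≤ ε₀`, every (7)-datum `V` admitting a background (14), and all critical
`U, W ∈ (6)(ε₀) ∩ fibre(V)` there are `v` with `v↓ = 1` and `κ > 0` with `κ·Σ_b‖(W^v)_bU_b⁻¹ − 1‖² ≤ A(W^v) − A(U)`, then the first conjunct of the stub
holds with that `a₀` (every `i`, `ε₀`, `ε₁`, `V`, `U₀` as registered).  The chart inside (4) costs nothing (`chart_optimal`); by `optimalGrowth_of_reprGrowth`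
the `ℓ²`-optimal representative is a universal witness for `v`. [cite: Balaban1985Variational, Prop. 7 p.299] -/
theorem clause1_of_reprGrowth {L : ℕ} {B₃ a₀ : ℝ}
    (hgrowth : ∀ (i : Idx L) (ε₀ ε₁ : ℝ), 0 < ε₁ → ε₀ ≤ a₀ → B₃ * ε₁ ≤ ε₀ →
      ∀ V : GaugeField (i.1.1.P i.1.2.1) 0 (Matrix.specialUnitaryGroup (Fin 2) ℂ), (famX L i).Reg7 ε₁ V →
      (∃ U₀ : GaugeField (i.1.1.P i.1.2.2) 0 (Matrix.specialUnitaryGroup (Fin 2) ℂ), (famX L i).InU ((L : ℝ) ^ 3 * B₃ * ε₁) U₀ ∧ (famX L i).InB V U₀) →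
      ∀ U W : GaugeField (i.1.1.P i.1.2.2) 0 (Matrix.specialUnitaryGroup (Fin 2) ℂ),
        U ∈ regFibrePr i.1.1 i.1.2.1 i.1.2.2 i.2.2.le ε₀ V → IsCritR2 i.1.1 i.1.2.1 i.1.2.2 i.2.2.le V U →
        W ∈ regFibrePr i.1.1 i.1.2.1 i.1.2.2 i.2.2.le ε₀ V → IsCritR2 i.1.1 i.1.2.1 i.1.2.2 i.2.2.le V W →
          ∃ v : GaugeTransf (i.1.1.P i.1.2.2) 0 (Matrix.specialUnitaryGroup (Fin 2) ℂ), descTransf i.1.1 i.1.2.1 i.1.2.2 i.2.2.le v = (fun _ => 1) ∧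
            ∃ κ : ℝ, 0 < κ ∧ κ * ∑ b : PBond (i.1.1.P i.1.2.2) 0, ‖pertVar U (GaugeField.gaugeAct v W) b‖ ^ 2 ≤
              wilsonAction4 (GaugeField.gaugeAct v W) - wilsonAction4 U) :
    ∀ (i : Idx L) (ε₀ ε₁ : ℝ), 0 < ε₁ → ∀ V : (famX L i).Bdry, (famX L i).Reg7 ε₁ V →
      ∀ U₀ : (famX L i).Cfg, (famX L i).InU ((L : ℝ) ^ 3 * B₃ * ε₁) U₀ → (famX L i).InB V U₀ →
        (ε₀ ≤ a₀ → B₃ * ε₁ ≤ ε₀ → (famX L i).AtMostOneCriticalOrbit ε₀ V) := by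
  intro i ε₀ ε₁ hε₁ V hV U₀ hU₀ hB₀ hε₀ hBε
  obtain ⟨⟨F, n, K⟩, hF, hnK⟩ := i
  -- `0 < L³B₃ε₁` (the background lies in a non-empty regular space), `L > 0`, hence `0 < B₃ε₁ ≤ ε₀`
  have hpos : 0 < (L : ℝ) ^ 3 * B₃ * ε₁ := T3SectALandauChart.pos_of_regPr F hU₀
  have hL0 : (0 : ℝ) < (L : ℝ) := by
    have h1 : 1 < F.L := F.hL.2
    have h2 : F.L = L := hF
    exact_mod_cast (show 0 < L by omega)
  have hBε₁ : 0 < B₃ * ε₁ := by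
    rw [mul_assoc] at hpos
    exact (mul_pos_iff_of_pos_left (pow_pos hL0 3)).mp hpos
  have hε : 0 ≤ ε₀ := hBε₁.le.trans hBε
  exact atMostOneCriticalOrbit_of_exists_reprGrowth F hnK.le hε V
    (hgrowth ⟨(F, n, K), hF, hnK⟩ ε₀ ε₁ hε₁ hε₀ hBε V hV ⟨U₀, hU₀, hB₀⟩)

end Summit.QuantumFields.YangMills.Theorems.Prop7CompactChart

end
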